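import Literature.NumberTheory.EllipticCurves.NeronModelSectionsSpecializationProofs
import Literature.NumberTheory.EllipticCurves.NeronModelAbelianSchemeProofs
import Literature.AlgebraicGeometry.Morphisms.SeparatedRigidityDedekind
import HarnessLib

/-!
# No divisible points on the generic fibre of a proper smooth group scheme over a Dedekind
# domain whose closed fibres have no divisible points

Proof-only assembly (no definitions, no named facts) of three landed pieces of the tree:

* `isNeronModel_of_isProper_of_smooth` (`NeronModelAbelianSchemeProofs`; BLR, *Néron Models*,
  Prop. 1.2/8): a proper smooth group scheme `𝒜` over a Dedekind domain `R` is the Néron model of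
  its generic fibre, so every `K`-point of the generic fibre extends to a section `Spec R ⟶ 𝒜`;
* `NeronModelSectionsSpecializationProofs` (junction J-c): the extension and the specialization of
  sections to the fibres `𝒜 ×_R R/𝔪` are group homomorphisms, so a divisible point gives a
  divisible section whose specializations are trivial wherever the fibre has no divisible points;
* `Morphisms/SeparatedRigidityDedekind` (junction J-d; Hartshorne II Ex. 4.2): two sections of a
  separated `R`-scheme agreeing at infinitely many closed points of `Spec R` are equal.

Result (`eq_one_of_forall_exists_pow_eq_of_forall_maximal`): **if `R` is a Dedekind domain with
infinitely many maximal ideals and fraction field `K`, `𝒜 → Spec R` a proper smooth group scheme such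
that for every maximal ideal `𝔪` the group `𝒜_𝔪(R/𝔪)` of `R/𝔪`-points of the fibre has no
non-trivial element admitting `n`-th roots for all `n ≥ 1`, and `E ≅ 𝒜_K` a group scheme over `K`,
then `E(K)` has no non-trivial element admitting `n`-th roots for all `n ≥ 1`.**  This is the
closed-point specialization step of [AbsTopIII] Rmk. 1.5.4 (i) p. 33 ("by restricting to various
closed points of this variety, one reduces to the case where `k` itself is an MLF"; route memo
`HOME/staging/f/f-083/g2/F0369-FG-ROUTE.md`, steps 3–7) in model form: the remaining inputs of the
induction for FACT-LIST row F-0369 are the spreading out `exists_abelianScheme_away_holds`, the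
arithmetic of `R[1/f]` and of the integral closure of `F[X]` (junctions J-a, J-a′) and, in positive
relative transcendence degree, Zariski connectedness (`Motives/ZariskiConnectednessDVR`, J-b).
Classical; nothing here bears on [IUTchIII] Cor. 3.12; typed ≠ discharged.

## References

* S. Bosch, W. Lütkebohmert, M. Raynaud, *Néron Models*, Springer 1990, Prop. 1.2/8.
  [BLRNeronModels1990]
* Q. Liu, *Algebraic Geometry and Arithmetic Curves*, OUP 2002, §10.2.2 (p. 499). [Liu2002]
* R. Hartshorne, *Algebraic Geometry*, II Ex. 4.2. [Hartshorne1977]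
* S. Mochizuki, *Topics in Absolute Anabelian Geometry III*, Rmk. 1.5.4 (i) p. 33.
  [MochizukiAbsTopIII2015]
-/

noncomputable section

universe u

open CategoryTheory CategoryTheory.Limits MonoidalCategory CartesianMonoidalCategory
open scoped MonObj CategoryTheory.Obj

namespace Literature.NumberTheory.EllipticCurves

open _root_.AlgebraicGeometry
open Literature.AlgebraicGeometry.Motives (SchemeOver specOver AlgPoints)
open Literature.AlgebraicGeometry.Morphisms (Over.tensorUnit_hom_ext_of_forall_maximal_quotient)

variable {R : Type u} [CommRing R] [IsDedekindDomain R] {K : Type u} [Field K] [Algebra R K]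

/-- **A divisible section of a Néron model with divisible-free closed fibres is the unit section.**
Let `R` be a Dedekind domain with infinitely many maximal ideals, `𝒩` a Néron model over `R` (of some
group scheme `E` over the fraction field `K`) such that for every maximal ideal `𝔪` no non-trivial
`R/𝔪`-point of the fibre `𝒩 ×_R R/𝔪` admits `n`-th roots for all `n ≥ 1`.  Then a section
`s : Spec R ⟶ 𝒩` admitting `n`-th roots for all `n ≥ 1` is the unit section: its specializations are
trivial (`specialization_comp_left_eq_of_forall_exists_pow_eq`) and sections of the separated `𝒩`
agreeing at every closed point are equal (`Over.tensorUnit_hom_ext_of_forall_maximal_quotient`).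
([AbsTopIII] Rmk. 1.5.4 (i) p. 33, closed-point step; Liu §10.2.2, p. 499.)
[cite: MochizukiAbsTopIII2015, Rmk 1.5.4 (i) p.33] -/
theorem IsNeronModel.section_eq_one_of_forall_exists_pow_eq
    (hR : {𝔪 : Ideal R | 𝔪.IsMaximal}.Infinite)
    {𝒩 : Over (Spec (.of R))} [GrpObj 𝒩] {E : Over (Spec (.of K))} [GrpObj E]
    (h : IsNeronModel R K 𝒩 E)
    (H𝔪 : ∀ (𝔪 : Ideal R) [𝔪.IsMaximal], letI := Ideal.Quotient.field 𝔪
      ∀ x : AlgPoints ((Over.pullback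
          (Spec.map (CommRingCat.ofHom (algebraMap R (R ⧸ 𝔪))))).obj 𝒩) (R ⧸ 𝔪),
        (∀ n : ℕ, 0 < n → ∃ y, y ^ n = x) → x = 1)
    (s : 𝟙_ (Over (Spec (.of R))) ⟶ 𝒩)
    (hs : ∀ n : ℕ, 0 < n → ∃ t : 𝟙_ (Over (Spec (.of R))) ⟶ 𝒩, t ^ n = s) : s = 1 := by
  haveI : IsSeparated 𝒩.hom := h.isSeparated
  refine Over.tensorUnit_hom_ext_of_forall_maximal_quotient hR s 1 fun 𝔪 h𝔪 => ?_
  haveI := h𝔪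
  letI := Ideal.Quotient.field 𝔪
  exact specialization_comp_left_eq_of_forall_exists_pow_eq 𝒩 (R ⧸ 𝔪) (H𝔪 𝔪) s hs

/-- **No divisible points on a group scheme with a Néron model whose closed fibres have no divisible
points.**  Let `R` be a Dedekind domain with infinitely many maximal ideals and fraction field `K`,
`𝒩` a Néron model of the group scheme `E / K` such that for every maximal ideal `𝔪` no non-trivial
`R/𝔪`-point of `𝒩 ×_R R/𝔪` admits `n`-th roots for all `n ≥ 1`.  Then no non-trivial `K`-point of `E`
admits `n`-th roots for all `n ≥ 1`: extend the point to a divisible section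
(`IsNeronModel.exists_section_of_forall_exists_pow_eq`), which is the unit section
(`IsNeronModel.section_eq_one_of_forall_exists_pow_eq`).  ([AbsTopIII] Rmk. 1.5.4 (i) p. 33;
Liu §10.2.2, p. 499, `E(K) = 𝒩(R) → 𝒩_s(k(s))`.) [cite: MochizukiAbsTopIII2015, Rmk 1.5.4 (i) p.33] -/
theorem IsNeronModel.eq_one_of_forall_exists_pow_eq
    (hR : {𝔪 : Ideal R | 𝔪.IsMaximal}.Infinite)
    {𝒩 : Over (Spec (.of R))} [GrpObj 𝒩] {E : Over (Spec (.of K))} [GrpObj E]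
    (h : IsNeronModel R K 𝒩 E)
    (H𝔪 : ∀ (𝔪 : Ideal R) [𝔪.IsMaximal], letI := Ideal.Quotient.field 𝔪
      ∀ x : AlgPoints ((Over.pullback
          (Spec.map (CommRingCat.ofHom (algebraMap R (R ⧸ 𝔪))))).obj 𝒩) (R ⧸ 𝔪),
        (∀ n : ℕ, 0 < n → ∃ y, y ^ n = x) → x = 1)
    (x : specOver K K ⟶ E) (hx : ∀ n : ℕ, 0 < n → ∃ y : specOver K K ⟶ E, y ^ n = x) :
    x = 1 := by
  obtain ⟨s, hsx, hs⟩ := h.exists_section_of_forall_exists_pow_eq x hx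
  rw [← hsx]
  exact h.toUnit_comp_sectionsEquiv_eq_one (h.section_eq_one_of_forall_exists_pow_eq hR H𝔪 s hs)

/-- **No divisible points on the generic fibre of a proper smooth group scheme over a Dedekind domain
whose closed fibres have no divisible points.**  Let `R` be a Dedekind domain with infinitely many
maximal ideals and fraction field `K`, `𝒜 → Spec R` a proper smooth group scheme such that for every
maximal ideal `𝔪` no non-trivial `R/𝔪`-point of the fibre `𝒜 ×_R R/𝔪` admits `n`-th roots for all
`n ≥ 1`, and `e : 𝒜_K ≅ E` an isomorphism of group schemes over `K`.  Then no non-trivial `K`-point of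
`E` admits `n`-th roots for all `n ≥ 1`.  `𝒜` is a Néron model of `E`
(`isNeronModel_of_isProper_of_smooth`, BLR Prop. 1.2/8; `IsNeronModel.of_iso_right`), so
`IsNeronModel.eq_one_of_forall_exists_pow_eq` applies.  ([AbsTopIII] Rmk. 1.5.4 (i) p. 33: "by
restricting to various closed points of this variety, one reduces to the case where `k` itself is an
MLF" — the model form of that reduction.) [cite: MochizukiAbsTopIII2015, Rmk 1.5.4 (i) p.33]
[cite: BLRNeronModels1990, Prop. 1.2/8] -/
theorem eq_one_of_forall_exists_pow_eq_of_forall_maximal [IsFractionRing R K]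
    (hR : {𝔪 : Ideal R | 𝔪.IsMaximal}.Infinite)
    (𝒜 : Over (Spec (.of R))) [GrpObj 𝒜] [IsProper 𝒜.hom] [Smooth 𝒜.hom]
    (H𝔪 : ∀ (𝔪 : Ideal R) [𝔪.IsMaximal], letI := Ideal.Quotient.field 𝔪
      ∀ x : AlgPoints ((Over.pullback
          (Spec.map (CommRingCat.ofHom (algebraMap R (R ⧸ 𝔪))))).obj 𝒜) (R ⧸ 𝔪),
        (∀ n : ℕ, 0 < n → ∃ y, y ^ n = x) → x = 1)
    {E : Over (Spec (.of K))} [GrpObj E] (e : (genericFibre R K).obj 𝒜 ≅ E) [IsMonHom e.hom]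
    (x : specOver K K ⟶ E) (hx : ∀ n : ℕ, 0 < n → ∃ y : specOver K K ⟶ E, y ^ n = x) :
    x = 1 :=
  ((isNeronModel_of_isProper_of_smooth R K 𝒜).of_iso_right e).eq_one_of_forall_exists_pow_eq
    hR H𝔪 x hx

end Literature.NumberTheory.EllipticCurves

end
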